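import Literature.AlgebraicGeometry.HodgeTheory.BettiLefschetzDecompositionHodgeStructures
import HarnessLib

/-!
# `HC(T × T')` for two smooth projective threefolds from TWO conditions: `Hom_HS(H³(T), H³(T')) = 0` and `dim_ℚ Hom_HS(H²(T), H²(T')) ≤ ρ(T) ρ(T')`
# (or `h^{2,0}(T) = 0`, or `h^{2,0}(T') = 0`, or the primitive count `≤ ρ₀ ρ₀'`) — the `H¹`-conditions of the lane's five-condition criterion are blocks of
# `Hom_HS(H³(T), H³(T'))` along `H³ = P³ ⊕ L H¹` (Voisin I Cor. 6.26, Rem. 6.27, Lemma 7.23, Lemma 7.26, §11.3.3; Lange Lemma 2.4.1)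

Family `hodge`, lane `lit-hodgefound` (Track 2 foundations library; Layers A1/A4), layer `Literature/AlgebraicGeometry/HodgeTheory`.  THEOREMS ONLY (no definition, no named fact,
no instance, no notation; D-0026 net debt `0`).  Prover seat `lit-hodgefound-p21` (generation 39, row g39-#3), sequel of the seat's g39-#1/#2 `BettiLefschetzDecompositionHodgeStructures`
(the Lefschetz decomposition `Hⁱ(X) = ⊕ Lᵗ Pᵃ(X)` as sub-Hodge structures, and `Hom_HS(Hⁱ(Y), Hʲ(Z)(s))` counted block by block through the primitive parts) applied to p29's
`BettiUniverse.hodgeConjectureFor_tensor_threefolds_of_hom_of_hardLefschetz` (`BettiHardLefschetzHodgeMorphisms`: `HC(T ⊗ T')` ⟸ `Hom_HS(H¹T, H¹T') = 0`, `Hom_HS(H¹T, H³T'(1)) = 0`,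
`Hom_HS(H¹T', H³T(1)) = 0`, `Hom_HS(H³T, H³T') = 0` and `dim Hom_HS(H²T, H²T') ≤ ρ(T)ρ(T')`).

THE MATHEMATICS.  For smooth projective `Y`, `Z` of dimension `≥ 2`, `H³ = P³ ⊕ L P¹` and `H¹ = P¹` (Cor. 6.26; the summand `P³` is absent in dimension `2`), as `ℚ`-Hodge structures with
`L P¹ ≅ P¹(−1)` (Rem. 6.27, Lemma 7.23).  A morphism of Hodge structures `H³(Y) → H³(Z)` is therefore a matrix of four blocks `P³(Y) → P³(Z)`, `P³(Y) → P¹(Z)(−1)`, `P¹(Y) → P³(Z)(1)`,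
`P¹(Y) → P¹(Z)`, and `Hom_HS(H³(Y), H³(Z)) = 0` kills all four.  But `Hom_HS(H¹(Y), H¹(Z)) = Hom_HS(P¹(Y), P¹(Z))` is the last block, `Hom_HS(H¹(Y), H³(Z)(1)) = Hom_HS(P¹(Y), P³(Z)(1)) ⊕
Hom_HS(P¹(Y), P¹(Z))` consists of the third and fourth, and `Hom_HS(H¹(Z), H³(Y)(1)) = Hom_HS(P¹(Z), P³(Y)(1)) ⊕ Hom_HS(P¹(Z), P¹(Y))` consists of the TRANSPOSES of the second and fourth
(for polarised structures `dim Hom_HS(A, B(s)) = dim Hom_HS(B, A(−s))`, Lange's Lemma 2.4.1; the primitive parts are polarisable, Lemma 7.26).  Hence for two threefolds `T`, `T'` the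
hypotheses `Hom_HS(H¹T, H¹T') = 0`, `Hom_HS(H¹T, H³T'(1)) = 0`, `Hom_HS(H¹T', H³T(1)) = 0` of the five-condition criterion all follow from `Hom_HS(H³T, H³T') = 0`, leaving **`HC(T × T')` ⟸
`Hom_HS(H³(T), H³(T')) = 0` ∧ `dim_ℚ Hom_HS(H²(T), H²(T')) ≤ ρ(T)ρ(T')`**; the count holds automatically when `h^{2,0}(T) = 0` or `h^{2,0}(T') = 0` (then `H²` is purely of type `(1,1)` on
one side and `dim Hom_HS(H²T, H²T') = b₂ ρ' = ρ ρ'`), which removes the irregularity hypotheses `q(T) = q(T') = 0` from p29's `…_of_q_zero_of_h20_zero_of_hom_three`; and it is equivalent to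
the primitive count `dim Hom_HS(P²(T), P²(T')) ≤ ρ₀(T)ρ₀(T')` (g39-#2).

THE PRINTS.  C. Voisin (2002) [VoisinHodgeI2002] §6.2.3 Thm. 6.25, Cor. 6.26, Rem. 6.27 (held text p0125–p0126: «a class is primitive if and only if its components of type `(p, q)` are
primitive»); §7.1.2 Lemma 7.26 (p0148); §7.3.1 Lemma 7.23, Cor. 7.24 (p0147); §11.3.3 Thm. 11.38, Def. 11.39, Thm. 11.40, Lemma 11.41 (p0236: a class of `Hᵏ(X) ⊗ Hˡ(Y)` «is a Hodge class
if and only if the corresponding morphism … is a morphism of Hodge structures»), p. 287; §11.3.1 Thm. 11.30.  C. Voisin (2003) [VoisinHodgeII2003] §9.2.4 Prop. 9.20.  H. Lange (2023)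
[Lange2023AbelianVarietiesComplex] §1.4.1, §2.4.1 Lemma 2.4.1 (the transpose `ᵗφ` with respect to polarisations).  P. Deligne (1971) [DeligneHodgeII1971] 2.1, 2.1.13–2.1.15.  P. Deligne
(2000) [Deligne2000] §1.

THE OBJECTS (all the tree's).  `Hⁱ(X) = BettiUniverse.hodge hHD hX i`, `Pᵃ(X) = BettiUniverse.primitiveHodge hHD hX D a` (g38-#7), Tate twists `H.tateTwist s` / `.cast`, `HodgeStructure.Hom`,
`Polarization.finrank_hom_eq_finrank_hom_swap` (p34), `finrank_hom_twistCast_left`, `BettiUniverse.subsingleton_hom_hodge[_tateTwist]_iff_primitiveHodge`,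
`BettiUniverse.finrank_hom_hodge_two_le_mul_iff_primitiveHodge` (g39-#1/#2), `BettiUniverse.hodgeConjectureFor_tensor_threefolds_of_hom_of_hardLefschetz`,
`BettiUniverse.hodgeClasses_hodge_two_eq_top_iff`, `BettiUniverse.finrank_hodgeClasses_tensor_hodge_of_hodgeClasses_eq_top_left/right`, `BettiUniverse.finrank_hodgeClasses_tensor_hodge_eq_finrank_hom`
(p29), `HodgeConjectureFor`; `ρ(X) = dim_ℚ Hdg¹(H²(X))`, `ρ₀(X) = dim_ℚ Hdg¹(P²(X))`, `h^{2,0}(X) = (BettiUniverse.hodge hHD hX 2).hodgeNumber 2 0`; `[HodgeTensorFacts.{0, 0}]` for the product statements.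

WHAT IS PROVED.
* §0 (abstract) `subsingleton_hom_twistCast_right_congr` (vanishing of `Hom_HS(H₁, H₂(s))` is insensitive to re-writing the twist `s = s'`), `subsingleton_hom_twistCast_zero_right_iff` (`H₂(0)` vs `H₂`).
* §1 TRANSPOSITION FOR PRIMITIVE PARTS: **`BettiUniverse.finrank_hom_primitiveHodge_tateTwist_swap`** (`dim Hom_HS(Pᵃ(Y), Pᵇ(Z)(s)) = dim Hom_HS(Pᵇ(Z), Pᵃ(Y)(−s))`),
  `BettiUniverse.subsingleton_hom_primitiveHodge_tateTwist_swap`.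
* §2 THE `H¹`-BLOCKS OF `Hom_HS(H³(Y), H³(Z))`: **`BettiUniverse.subsingleton_hom_hodge_one_of_three`** (`Hom_HS(H³Y, H³Z) = 0 ⟹ Hom_HS(H¹Y, H¹Z) = 0`, `dim Y, dim Z ≥ 2`),
  **`BettiUniverse.subsingleton_hom_hodge_one_three_twist_of_three`** (`⟹ Hom_HS(H¹Y, H³Z(1)) = 0`, `dim Y ≥ 2`), **`BettiUniverse.subsingleton_hom_hodge_one_three_twist_of_three_swap`**
  (`⟹ Hom_HS(H¹Z, H³Y(1)) = 0`, `dim Z ≥ 2`).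
* §3 THE CRITERIA: **`BettiUniverse.hodgeConjectureFor_tensor_threefolds_of_subsingleton_hom_three_of_finrank_hom_le`** (`HC(T ⊗ T')` ⟸ `Hom_HS(H³T, H³T') = 0` ∧ `dim Hom_HS(H²T, H²T') ≤ ρρ'`),
  `…_of_finrank_hom_primitiveHodge_le` (the count on `P²`: `≤ ρ₀ρ₀'`), **`BettiUniverse.hodgeConjectureFor_tensor_threefolds_of_h20_zero_of_subsingleton_hom_three`** (`h^{2,0}(T) = 0` ∧
  `Hom_HS(H³T, H³T') = 0`), `…_of_h20_zero_right_of_subsingleton_hom_three` (`h^{2,0}(T') = 0`).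
* §4 DEGREE-THREE CLOSED FORMS: `BettiUniverse.subtypeHom_primitiveSubHodge_bijective_of_le_one` (`Pᵃ(X) = Hᵃ(X)` as Hodge structures, `a ≤ 1`), `finrank_hom_primitiveHodge_left_of_le_one`,
  `finrank_hom_primitiveHodge_tateTwist_right_of_le_one`; **`BettiUniverse.finrank_hom_hodge_three_eq_primitiveHodge`** (`dim Hom_HS(H³(Y), H³(Z)) = dim Hom_HS(P³(Y), P³(Z)) +
  dim Hom_HS(P³(Y), H¹(Z)(−1)) + dim Hom_HS(H¹(Y), P³(Z)(1)) + dim Hom_HS(H¹(Y), H¹(Z))`, `dim Y, dim Z ≥ 3`), **`BettiUniverse.finrank_hom_hodge_one_three_twist_eq_primitiveHodge`**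
  (`dim Hom_HS(H¹(Y), H³(Z)(1)) = dim Hom_HS(H¹(Y), P³(Z)(1)) + dim Hom_HS(H¹(Y), H¹(Z))`, `dim Z ≥ 3`).
* §5 LEFSCHETZ MONOTONICITY OF `Hom`-VANISHING (the general form of §2): **`BettiUniverse.subsingleton_hom_hodge_tateTwist_of_shift`** (`Hom_HS(H^{i+2k}(Y), H^{j+2k'}(Z)(s + k' − k)) = 0 ⟹
  Hom_HS(Hⁱ(Y), Hʲ(Z)(s)) = 0` for `i + k ≤ dim Y`, `j + k' ≤ dim Z`: each block of the latter is a block of the former), `BettiUniverse.subsingleton_hom_hodge_of_shift` (`k = k'`, untwisted),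
  `BettiUniverse.subsingleton_hom_hodge_tateTwist_of_shift_left` (`k' = 0`: `Hom_HS(H^{i+2k}(Y), H^{i+2k}(Z)) = 0 ⟹ Hom_HS(Hⁱ(Y), H^{i+2k}(Z)(k)) = 0`).

DEVIATIONS / SCOPE.  `Hom_HS(H³(T), H³(T')) = 0` is slightly stronger than needed: the block `Hom_HS(P¹T, P¹T') = Hom_HS(H¹T, H¹T')` is not used by the primitive four-condition criterion
(g38-#8 `…_of_hom_primitive`), which remains the sharp form; the present statements are the ones expressible on the full cohomology.  The Kähler–rational data enter only the `ρ₀`-variant.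

## References
* [VoisinHodgeI2002] C. Voisin, *Hodge Theory and Complex Algebraic Geometry I* (2002) — §6.2.3 Thm. 6.25, Cor. 6.26, Rem. 6.27; §7.1.2 Lemma 7.26; §7.3.1 Lemma 7.23, Cor. 7.24; §11.3.3
  Thm. 11.38–11.40, Lemma 11.41, p. 287; §11.3.1 Thm. 11.30.
* [VoisinHodgeII2003] C. Voisin, *Hodge Theory and Complex Algebraic Geometry II* (2003) — §9.2.4 Prop. 9.20.
* [Lange2023AbelianVarietiesComplex] H. Lange, *Abelian Varieties over the Complex Numbers* (2023) — §1.4.1, §2.4.1 Lemma 2.4.1.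
* [DeligneHodgeII1971] P. Deligne, *Théorie de Hodge II*, Publ. Math. IHÉS 40 (1971) — 2.1, 2.1.13–2.1.15.
* [Deligne2000] P. Deligne, *The Hodge conjecture* (Clay, 2000) — §1.

## Provenance
Lane `lit-hodgefound` (Hodge path, Track 2), prover seat `lit-hodgefound-p21` (generation 39), self-proposed row g39-#3 (sequel of g39-#1/#2; uses p29's `BettiHardLefschetzHodgeMorphisms`,
`BettiPicardNumberOfProducts`, `BettiKunnethHodgeClassesHodgeMorphisms` and p34's `Motives/HodgeStructurePolarizationTransposeHom`).
-/

noncomputable section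

open scoped TensorProduct
open CategoryTheory MonoidalCategory Module Finset
open Literature.AlgebraicTopology.SingularHomology
open Literature.Geometry.Kaehler

namespace Literature.AlgebraicGeometry.Motives.HodgeStructure

section SubsingletonTwist

universe u v

variable {V : Type u} [AddCommGroup V] [Module ℚ V] {W : Type v} [AddCommGroup W] [Module ℚ W] {w w₂ : ℤ}

/-- Changing the twist of the target of a morphism space along an equality of twists (same space, same filtration): vanishing is unaffected. [cite: DeligneHodgeII1971, 2.1.13–2.1.14] -/
theorem subsingleton_hom_twistCast_right_congr (H₁ : HodgeStructure V w) (H₂ : HodgeStructure W w₂) {s s' : ℤ} (hs : s = s') (h : w₂ - 2 * s = w) (h' : w₂ - 2 * s' = w) :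
    Subsingleton (Hom H₁ ((H₂.tateTwist s).cast h)) ↔ Subsingleton (Hom H₁ ((H₂.tateTwist s').cast h')) := by
  subst hs
  exact Iff.rfl

/-- Vanishing of `Hom_HS(H₁, H₂(0))` is vanishing of `Hom_HS(H₁, H₂)` (`Fᵖ H(0) = Fᵖ H`; same linear maps). [cite: DeligneHodgeII1971, 2.1.13–2.1.14] -/
theorem subsingleton_hom_twistCast_zero_right_iff (H₁ : HodgeStructure V w) (H₂ : HodgeStructure W w) (h0 : w - 2 * 0 = w) : Subsingleton (Hom H₁ ((H₂.tateTwist 0).cast h0)) ↔ Subsingleton (Hom H₁ H₂) := by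
  constructor <;> intro h <;> refine ⟨fun f g ↦ Hom.ext ?_⟩
  · have e := congrArg Hom.toLinearMap (h.elim (⟨f.toLinearMap, fun p ↦ by rw [cast_F, tateTwist_F, add_zero]; exact f.map_F_le p⟩ : Hom H₁ ((H₂.tateTwist 0).cast h0))
      ⟨g.toLinearMap, fun p ↦ by rw [cast_F, tateTwist_F, add_zero]; exact g.map_F_le p⟩)
    exact e
  · have e := congrArg Hom.toLinearMap (h.elim (⟨f.toLinearMap, fun p ↦ by have e := f.map_F_le p; rw [cast_F, tateTwist_F, add_zero] at e; exact e⟩ : Hom H₁ H₂)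
      ⟨g.toLinearMap, fun p ↦ by have e := g.map_F_le p; rw [cast_F, tateTwist_F, add_zero] at e; exact e⟩)
    exact e

end SubsingletonTwist

end Literature.AlgebraicGeometry.Motives.HodgeStructure

namespace Literature.AlgebraicGeometry.HodgeTheory

open Literature.AlgebraicGeometry.Motives
open Literature.AlgebraicGeometry.Motives.HodgeStructure

variable {m n : ℕ} {X Y Z T T' : SchemeOver ℂ}

section Criterion

/-- `Hom_HS(H₁, H₂)` is finite-dimensional for finite-dimensional carriers. [folklore] -/
private theorem homFinite₃ {V : Type} [AddCommGroup V] [Module ℚ V] {W : Type} [AddCommGroup W] [Module ℚ W] [Module.Finite ℚ V] [Module.Finite ℚ W] {w : ℤ}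
    (H₁ : HodgeStructure V w) (H₂ : HodgeStructure W w) : Module.Finite ℚ (Hom H₁ H₂) :=
  Module.Finite.of_injective ({ toFun := Hom.toLinearMap, map_add' := fun _ _ ↦ rfl, map_smul' := fun _ _ ↦ rfl } : Hom H₁ H₂ →ₗ[ℚ] (V →ₗ[ℚ] W))
    Hom.toLinearMap_injective

/-- **Transposition for the primitive parts: `dim_ℚ Hom_HS(Pᵃ(Y), Pᵇ(Z)(s)) = dim_ℚ Hom_HS(Pᵇ(Z), Pᵃ(Y)(−s))`** (`b − 2s = a`): the transpose `φ ↦ ᵗφ` with respect to polarisations of the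
(polarisable, Lemma 7.26) primitive parts, then the twist moved to the other side. [cite: Lange2023AbelianVarietiesComplex, §1.4.1 and §2.4.1 Lemma 2.4.1] [cite: VoisinHodgeI2002, §7.1.2 Lemma 7.26]
[cite: DeligneHodgeII1971, 2.1.13–2.1.15] -/
theorem BettiUniverse.finrank_hom_primitiveHodge_tateTwist_swap (hHD : exists_isReal_hodgeModel) (hY : IsSmoothProjective m Y) (hZ : IsSmoothProjective n Z)
    (DY : KaehlerRationalDatum m Y) (DZ : KaehlerRationalDatum n Z) (a b : ℕ) {s s' : ℤ} (hs : -s = s') (hw : (b : ℤ) - 2 * s = a) (hw' : (a : ℤ) - 2 * s' = b) :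
    Module.finrank ℚ (Hom (BettiUniverse.primitiveHodge hHD hY DY a) (((BettiUniverse.primitiveHodge hHD hZ DZ b).tateTwist s).cast hw)) =
      Module.finrank ℚ (Hom (BettiUniverse.primitiveHodge hHD hZ DZ b) (((BettiUniverse.primitiveHodge hHD hY DY a).tateTwist s').cast hw')) := by
  haveI := BettiUniverse.finite hY a
  haveI := BettiUniverse.finite hZ b
  obtain ⟨Q₁⟩ := BettiUniverse.primitiveHodge_isPolarizable hHD hY DY a
  obtain ⟨Q₂⟩ := BettiUniverse.primitiveHodge_isPolarizable hHD hZ DZ b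
  rw [Q₁.finrank_hom_eq_finrank_hom_swap ((Q₂.tateTwist s).cast hw), finrank_hom_twistCast_left _ _ hs hw hw']

/-- **`Hom_HS(Pᵃ(Y), Pᵇ(Z)(s)) = 0 ⟺ Hom_HS(Pᵇ(Z), Pᵃ(Y)(−s)) = 0`.** [cite: Lange2023AbelianVarietiesComplex, §2.4.1 Lemma 2.4.1] [cite: VoisinHodgeI2002, §7.1.2 Lemma 7.26] -/
theorem BettiUniverse.subsingleton_hom_primitiveHodge_tateTwist_swap (hHD : exists_isReal_hodgeModel) (hY : IsSmoothProjective m Y) (hZ : IsSmoothProjective n Z)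
    (DY : KaehlerRationalDatum m Y) (DZ : KaehlerRationalDatum n Z) (a b : ℕ) {s s' : ℤ} (hs : -s = s') (hw : (b : ℤ) - 2 * s = a) (hw' : (a : ℤ) - 2 * s' = b) :
    Subsingleton (Hom (BettiUniverse.primitiveHodge hHD hY DY a) (((BettiUniverse.primitiveHodge hHD hZ DZ b).tateTwist s).cast hw)) ↔
      Subsingleton (Hom (BettiUniverse.primitiveHodge hHD hZ DZ b) (((BettiUniverse.primitiveHodge hHD hY DY a).tateTwist s').cast hw')) := by
  haveI := BettiUniverse.finite hY a
  haveI := BettiUniverse.finite hZ b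
  haveI := homFinite₃ (BettiUniverse.primitiveHodge hHD hY DY a) (((BettiUniverse.primitiveHodge hHD hZ DZ b).tateTwist s).cast hw)
  haveI := homFinite₃ (BettiUniverse.primitiveHodge hHD hZ DZ b) (((BettiUniverse.primitiveHodge hHD hY DY a).tateTwist s').cast hw')
  rw [← Module.finrank_zero_iff (R := ℚ), ← Module.finrank_zero_iff (R := ℚ), BettiUniverse.finrank_hom_primitiveHodge_tateTwist_swap hHD hY hZ DY DZ a b hs hw hw']

/-- The Lefschetz index set of degree `1` is `{(1, 0)}` (`H¹ = P¹`). [folklore] -/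
private theorem lefschetzIndex_one_eq (p : {p : ℕ × ℕ // p.1 + 2 * p.2 = 1}) : p = ⟨(1, 0), rfl⟩ := by
  obtain ⟨⟨a, t⟩, h⟩ := p
  have h' : a + 2 * t = 1 := h
  exact Subtype.ext (Prod.ext (by show a = 1; omega) (by show t = 0; omega))

/-- The Lefschetz index set of degree `3` is `{(3, 0), (1, 1)}` (`H³ = P³ ⊕ L P¹`). [folklore] -/
private theorem lefschetzIndex_three_eq (p : {p : ℕ × ℕ // p.1 + 2 * p.2 = 3}) : p = ⟨(3, 0), rfl⟩ ∨ p = ⟨(1, 1), rfl⟩ := by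
  obtain ⟨⟨a, t⟩, h⟩ := p
  have h' : a + 2 * t = 3 := h
  rcases Nat.lt_or_ge t 1 with ht | ht
  · left
    exact Subtype.ext (Prod.ext (by show a = 3; omega) (by show t = 0; omega))
  · right
    exact Subtype.ext (Prod.ext (by show a = 1; omega) (by show t = 1; omega))

/-- **`Hom_HS(H³(Y), H³(Z)) = 0 ⟹ Hom_HS(H¹(Y), H¹(Z)) = 0`** for `dim Y, dim Z ≥ 2`: `L H¹ ⊆ H³` is a Lefschetz summand on both sides and `Hom_HS(L H¹(Y), L H¹(Z)) ≅ Hom_HS(H¹(Y), H¹(Z))` is a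
block of `Hom_HS(H³(Y), H³(Z))`. [cite: VoisinHodgeI2002, §6.2.3 Thm. 6.25, Cor. 6.26, Rem. 6.27 and §7.3.1 Lemma 7.23, Lemma 7.26] [cite: DeligneHodgeII1971, 2.1] -/
theorem BettiUniverse.subsingleton_hom_hodge_one_of_three (hHD : exists_isReal_hodgeModel) (hY : IsSmoothProjective m Y) (hZ : IsSmoothProjective n Z) (hm : 2 ≤ m) (hn : 2 ≤ n)
    (h33 : Subsingleton (Hom (BettiUniverse.hodge hHD hY 3) (BettiUniverse.hodge hHD hZ 3))) :
    Subsingleton (Hom (BettiUniverse.hodge hHD hY 1) (BettiUniverse.hodge hHD hZ 1)) := by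
  obtain ⟨DY⟩ := nonempty_kaehlerRationalDatum hY
  obtain ⟨DZ⟩ := nonempty_kaehlerRationalDatum hZ
  have hb := (BettiUniverse.subsingleton_hom_hodge_iff_primitiveHodge hHD hY hZ DY DZ 3).1 h33 ⟨(1, 1), rfl⟩ ⟨(1, 1), rfl⟩ (by show 1 + 1 ≤ m; omega)
    (by show 1 + 1 ≤ n; omega)
  rw [BettiUniverse.subsingleton_hom_hodge_iff_primitiveHodge hHD hY hZ DY DZ 1]
  intro p q _ _
  obtain rfl := lefschetzIndex_one_eq p
  obtain rfl := lefschetzIndex_one_eq q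
  exact (subsingleton_hom_twistCast_right_congr _ _ (by norm_num) _ _).1 hb

/-- **`Hom_HS(H³(Y), H³(Z)) = 0 ⟹ Hom_HS(H¹(Y), H³(Z)(1)) = 0`** for `dim Y ≥ 2`: `Hom_HS(H¹(Y), H³(Z)(1)) ≅ Hom_HS(L H¹(Y), H³(Z))` (`L H¹(Y) ≅ H¹(Y)(−1)`) is the restriction of
`Hom_HS(H³(Y), H³(Z))` to the summand `L H¹(Y) ⊆ H³(Y)` — block by block, `Hom_HS(P¹(Y), P³(Z)(1))` and `Hom_HS(P¹(Y), P¹(Z))`.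
[cite: VoisinHodgeI2002, §6.2.3 Thm. 6.25, Cor. 6.26, Rem. 6.27 and §7.3.1 Lemma 7.23, Lemma 7.26] [cite: DeligneHodgeII1971, 2.1, 2.1.13–2.1.14] -/
theorem BettiUniverse.subsingleton_hom_hodge_one_three_twist_of_three (hHD : exists_isReal_hodgeModel) (hY : IsSmoothProjective m Y) (hZ : IsSmoothProjective n Z) (hm : 2 ≤ m)
    (h33 : Subsingleton (Hom (BettiUniverse.hodge hHD hY 3) (BettiUniverse.hodge hHD hZ 3))) :
    Subsingleton (Hom (BettiUniverse.hodge hHD hY 1) (((BettiUniverse.hodge hHD hZ 3).tateTwist 1).cast (by norm_num))) := by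
  obtain ⟨DY⟩ := nonempty_kaehlerRationalDatum hY
  obtain ⟨DZ⟩ := nonempty_kaehlerRationalDatum hZ
  have hb := (BettiUniverse.subsingleton_hom_hodge_iff_primitiveHodge hHD hY hZ DY DZ 3).1 h33
  rw [BettiUniverse.subsingleton_hom_hodge_tateTwist_iff_primitiveHodge hHD hY hZ DY DZ 1 3]
  intro p q _ hq
  obtain rfl := lefschetzIndex_one_eq p
  rcases lefschetzIndex_three_eq q with rfl | rfl
  · exact (subsingleton_hom_twistCast_right_congr _ _ (by norm_num) _ _).1 (hb ⟨(1, 1), rfl⟩ ⟨(3, 0), rfl⟩ (by show 1 + 1 ≤ m; omega) hq)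
  · exact (subsingleton_hom_twistCast_right_congr _ _ (by norm_num) _ _).1 (hb ⟨(1, 1), rfl⟩ ⟨(1, 1), rfl⟩ (by show 1 + 1 ≤ m; omega) hq)

/-- **`Hom_HS(H³(Y), H³(Z)) = 0 ⟹ Hom_HS(H¹(Z), H³(Y)(1)) = 0`** for `dim Z ≥ 2` (the transposed blocks: `Hom_HS(P³(Y), P¹(Z)(−1)) = 0 ⟺ Hom_HS(P¹(Z), P³(Y)(1)) = 0` and
`Hom_HS(P¹(Y), P¹(Z)) = 0 ⟺ Hom_HS(P¹(Z), P¹(Y)) = 0` for the polarised primitive parts). [cite: VoisinHodgeI2002, §6.2.3 Cor. 6.26, Rem. 6.27, §7.1.2 Lemma 7.26 and §7.3.1 Lemma 7.23]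
[cite: Lange2023AbelianVarietiesComplex, §2.4.1 Lemma 2.4.1] [cite: DeligneHodgeII1971, 2.1, 2.1.13–2.1.15] -/
theorem BettiUniverse.subsingleton_hom_hodge_one_three_twist_of_three_swap (hHD : exists_isReal_hodgeModel) (hY : IsSmoothProjective m Y) (hZ : IsSmoothProjective n Z) (hn : 2 ≤ n)
    (h33 : Subsingleton (Hom (BettiUniverse.hodge hHD hY 3) (BettiUniverse.hodge hHD hZ 3))) :
    Subsingleton (Hom (BettiUniverse.hodge hHD hZ 1) (((BettiUniverse.hodge hHD hY 3).tateTwist 1).cast (by norm_num))) := by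
  obtain ⟨DY⟩ := nonempty_kaehlerRationalDatum hY
  obtain ⟨DZ⟩ := nonempty_kaehlerRationalDatum hZ
  have hb := (BettiUniverse.subsingleton_hom_hodge_iff_primitiveHodge hHD hY hZ DY DZ 3).1 h33
  rw [BettiUniverse.subsingleton_hom_hodge_tateTwist_iff_primitiveHodge hHD hZ hY DZ DY 1 3]
  intro p q _ hq
  obtain rfl := lefschetzIndex_one_eq p
  rcases lefschetzIndex_three_eq q with rfl | rfl
  · exact (subsingleton_hom_twistCast_right_congr _ _ (by norm_num) _ _).1
      ((BettiUniverse.subsingleton_hom_primitiveHodge_tateTwist_swap hHD hY hZ DY DZ 3 1 rfl _ (by norm_num)).1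
        (hb ⟨(3, 0), rfl⟩ ⟨(1, 1), rfl⟩ hq (by show 1 + 1 ≤ n; omega)))
  · exact (subsingleton_hom_twistCast_right_congr _ _ (by norm_num) _ _).1
      ((BettiUniverse.subsingleton_hom_primitiveHodge_tateTwist_swap hHD hY hZ DY DZ 1 1 rfl _ (by norm_num)).1
        (hb ⟨(1, 1), rfl⟩ ⟨(1, 1), rfl⟩ hq (by show 1 + 1 ≤ n; omega)))

variable [HodgeTensorFacts.{0, 0}]

/-- **`HC(T × T')` FOR TWO SMOOTH PROJECTIVE THREEFOLDS WITH `Hom_HS(H³(T), H³(T')) = 0` AND `dim_ℚ Hom_HS(H²(T), H²(T')) ≤ ρ(T) ρ(T')`** — TWO conditions for the lane's five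
(p29's `…_of_hom_of_hardLefschetz`: `Hom_HS(H¹T, H¹T') = 0`, `Hom_HS(H¹T, H³T'(1)) = 0`, `Hom_HS(H¹T', H³T(1)) = 0`, `Hom_HS(H³T, H³T') = 0` and the count): the three `H¹`-conditions are blocks,
or transposes of blocks, of `Hom_HS(H³(T), H³(T'))` along the Lefschetz decompositions `H³ = P³ ⊕ L H¹`. [cite: VoisinHodgeI2002, §6.2.3 Cor. 6.26, Rem. 6.27, §7.3.1 Lemma 7.23, Lemma 7.26,
§11.3.3 Thm. 11.38–11.40, Lemma 11.41, p. 287 and §11.3.1 Thm. 11.30] [cite: VoisinHodgeII2003, §9.2.4 Prop. 9.20] [cite: Deligne2000, §1] [cite: DeligneHodgeII1971, 2.1, 2.1.13–2.1.15] -/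
theorem BettiUniverse.hodgeConjectureFor_tensor_threefolds_of_subsingleton_hom_three_of_finrank_hom_le (hHD : exists_isReal_hodgeModel) (hT : IsSmoothProjective 3 T)
    (hT' : IsSmoothProjective 3 T') (hTT' : IsSmoothProjective 6 (T ⊗ T')) (h33 : Subsingleton (Hom (BettiUniverse.hodge hHD hT 3) (BettiUniverse.hodge hHD hT' 3)))
    (h22 : Module.finrank ℚ (Hom (BettiUniverse.hodge hHD hT 2) (BettiUniverse.hodge hHD hT' 2)) ≤
      Module.finrank ℚ ↥((BettiUniverse.hodge hHD hT 2).hodgeClasses 1) * Module.finrank ℚ ↥((BettiUniverse.hodge hHD hT' 2).hodgeClasses 1)) :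
    HodgeConjectureFor 6 (T ⊗ T') :=
  BettiUniverse.hodgeConjectureFor_tensor_threefolds_of_hom_of_hardLefschetz hHD hT hT' hTT' (BettiUniverse.subsingleton_hom_hodge_one_of_three hHD hT hT' (by norm_num) (by norm_num) h33)
    (BettiUniverse.subsingleton_hom_hodge_one_three_twist_of_three hHD hT hT' (by norm_num) h33)
    (BettiUniverse.subsingleton_hom_hodge_one_three_twist_of_three_swap hHD hT hT' (by norm_num) h33) h33 h22

/-- The same with the count on the PRIMITIVE parts: **`HC(T × T')` if `Hom_HS(H³(T), H³(T')) = 0` and `dim_ℚ Hom_HS(P²(T), P²(T')) ≤ ρ₀(T) ρ₀(T')`** (`ρ₀ = dim Hdg¹(P²) = ρ − 1`; the two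
counts are equivalent, §6). [cite: VoisinHodgeI2002, §6.2.3 Cor. 6.26, Rem. 6.27, §11.3.3 Thm. 11.38–11.40, Lemma 11.41, p. 287 and §11.3.1 Thm. 11.30] [cite: VoisinHodgeII2003, §9.2.4 Prop. 9.20]
[cite: Deligne2000, §1] -/
theorem BettiUniverse.hodgeConjectureFor_tensor_threefolds_of_subsingleton_hom_three_of_finrank_hom_primitiveHodge_le (hHD : exists_isReal_hodgeModel)
    (hT : IsSmoothProjective 3 T) (hT' : IsSmoothProjective 3 T') (hTT' : IsSmoothProjective 6 (T ⊗ T')) (D : KaehlerRationalDatum 3 T) (D' : KaehlerRationalDatum 3 T')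
    (h33 : Subsingleton (Hom (BettiUniverse.hodge hHD hT 3) (BettiUniverse.hodge hHD hT' 3)))
    (h22 : Module.finrank ℚ (Hom (BettiUniverse.primitiveHodge hHD hT D 2) (BettiUniverse.primitiveHodge hHD hT' D' 2)) ≤
      Module.finrank ℚ ↥((BettiUniverse.primitiveHodge hHD hT D 2).hodgeClasses 1) * Module.finrank ℚ ↥((BettiUniverse.primitiveHodge hHD hT' D' 2).hodgeClasses 1)) :
    HodgeConjectureFor 6 (T ⊗ T') :=
  BettiUniverse.hodgeConjectureFor_tensor_threefolds_of_subsingleton_hom_three_of_finrank_hom_le hHD hT hT' hTT' h33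
    ((BettiUniverse.finrank_hom_hodge_two_le_mul_iff_primitiveHodge hHD hT hT' D D' (by norm_num) (by norm_num)).2 h22)

/-- **`HC(T × T')` if `h^{2,0}(T) = 0` and `Hom_HS(H³(T), H³(T')) = 0`** (then `H²(T)` is purely of type `(1, 1)` and `dim Hom_HS(H²T, H²T') = b₂(T) ρ(T') = ρ(T) ρ(T')`; p29's
`…_of_q_zero_of_h20_zero_of_hom_three` without its irregularity hypotheses `q(T) = q(T') = 0`). [cite: VoisinHodgeI2002, §6.2.3 Cor. 6.26, Rem. 6.27, §11.3.3 Thm. 11.38–11.40, Lemma 11.41, p. 287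
and §11.3.1 Thm. 11.30] [cite: DeligneHodgeII1971, 2.1.13] [cite: Deligne2000, §1] -/
theorem BettiUniverse.hodgeConjectureFor_tensor_threefolds_of_h20_zero_of_subsingleton_hom_three (hHD : exists_isReal_hodgeModel) (hT : IsSmoothProjective 3 T)
    (hT' : IsSmoothProjective 3 T') (hTT' : IsSmoothProjective 6 (T ⊗ T')) (h20 : (BettiUniverse.hodge hHD hT 2).hodgeNumber 2 0 = 0)
    (h33 : Subsingleton (Hom (BettiUniverse.hodge hHD hT 3) (BettiUniverse.hodge hHD hT' 3))) : HodgeConjectureFor 6 (T ⊗ T') := by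
  haveI := BettiUniverse.finite hT 2
  haveI := BettiUniverse.finite hT' 2
  refine BettiUniverse.hodgeConjectureFor_tensor_threefolds_of_subsingleton_hom_three_of_finrank_hom_le hHD hT hT' hTT' h33 (le_of_eq ?_)
  have htop : (BettiUniverse.hodge hHD hT 2).hodgeClasses 1 = ⊤ := (BettiUniverse.hodgeClasses_hodge_two_eq_top_iff hHD hT).2 h20
  have e := BettiUniverse.finrank_hodgeClasses_tensor_hodge_of_hodgeClasses_eq_top_left hHD hT hT' (i := 2) (a := 1) (by norm_num) htop 2 1
  rw [show (1 : ℤ) + 1 = ((2 : ℕ) : ℤ) by norm_num] at e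
  rw [← BettiUniverse.finrank_hodgeClasses_tensor_hodge_eq_finrank_hom hHD hT hT' 2, e, htop, finrank_top]

/-- The mirror: **`HC(T × T')` if `h^{2,0}(T') = 0` and `Hom_HS(H³(T), H³(T')) = 0`.** [cite: VoisinHodgeI2002, §6.2.3 Cor. 6.26, Rem. 6.27, §11.3.3 Thm. 11.38–11.40, Lemma 11.41, p. 287 and §11.3.1 Thm. 11.30]
[cite: DeligneHodgeII1971, 2.1.13] [cite: Deligne2000, §1] -/
theorem BettiUniverse.hodgeConjectureFor_tensor_threefolds_of_h20_zero_right_of_subsingleton_hom_three (hHD : exists_isReal_hodgeModel) (hT : IsSmoothProjective 3 T)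
    (hT' : IsSmoothProjective 3 T') (hTT' : IsSmoothProjective 6 (T ⊗ T')) (h20' : (BettiUniverse.hodge hHD hT' 2).hodgeNumber 2 0 = 0)
    (h33 : Subsingleton (Hom (BettiUniverse.hodge hHD hT 3) (BettiUniverse.hodge hHD hT' 3))) : HodgeConjectureFor 6 (T ⊗ T') := by
  haveI := BettiUniverse.finite hT 2
  haveI := BettiUniverse.finite hT' 2
  refine BettiUniverse.hodgeConjectureFor_tensor_threefolds_of_subsingleton_hom_three_of_finrank_hom_le hHD hT hT' hTT' h33 (le_of_eq ?_)
  have htop : (BettiUniverse.hodge hHD hT' 2).hodgeClasses 1 = ⊤ := (BettiUniverse.hodgeClasses_hodge_two_eq_top_iff hHD hT').2 h20'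
  have e := BettiUniverse.finrank_hodgeClasses_tensor_hodge_of_hodgeClasses_eq_top_right hHD hT hT' 2 (j := 2) (a := 1) (by norm_num) htop 1
  rw [show (1 : ℤ) + 1 = ((2 : ℕ) : ℤ) by norm_num] at e
  rw [← BettiUniverse.finrank_hodgeClasses_tensor_hodge_eq_finrank_hom hHD hT hT' 2, e, htop, finrank_top]

end Criterion

section DegreeThree

/-- `P^a(X) = H^a(X)` as Hodge structures for `a ≤ 1` (`a ≤ dim X`): the inclusion is a bijective morphism. [cite: VoisinHodgeI2002, §6.2.3 Def. 6.24, Cor. 6.26 and §7.3.1 Lemma 7.23] -/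
theorem BettiUniverse.subtypeHom_primitiveSubHodge_bijective_of_le_one (hHD : exists_isReal_hodgeModel) (hX : IsSmoothProjective n X) (D : KaehlerRationalDatum n X) {a : ℕ}
    (ha1 : a ≤ 1) (han : a ≤ n) : Function.Bijective (BettiUniverse.primitiveSubHodge hHD hX D a).subtypeHom.toLinearMap := by
  refine ⟨Subtype.val_injective, fun x ↦ ⟨⟨x, ?_⟩, rfl⟩⟩
  change x ∈ primitiveClasses D.η n a
  rw [BettiUniverse.primitiveClasses_eq_top_of_le_one D.η hX ha1 han]
  exact Submodule.mem_top

/-- `dim Hom_HS(Pᵃ(X), K) = dim Hom_HS(Hᵃ(X), K)` for `a ≤ 1`. [cite: VoisinHodgeI2002, §6.2.3 Cor. 6.26 and §7.3.1 Lemma 7.23] -/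
theorem BettiUniverse.finrank_hom_primitiveHodge_left_of_le_one (hHD : exists_isReal_hodgeModel) (hX : IsSmoothProjective n X) (D : KaehlerRationalDatum n X) {a : ℕ} (ha1 : a ≤ 1)
    (han : a ≤ n) {W : Type} [AddCommGroup W] [Module ℚ W] (K : HodgeStructure W (a : ℤ)) :
    Module.finrank ℚ (Hom (BettiUniverse.primitiveHodge hHD hX D a) K) = Module.finrank ℚ (Hom (BettiUniverse.hodge hHD hX a) K) :=
  (Hom.finrank_hom_eq_of_bijective _ (BettiUniverse.subtypeHom_primitiveSubHodge_bijective_of_le_one hHD hX D ha1 han) K).symm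

/-- `dim Hom_HS(K, Pᵃ(X)(s)) = dim Hom_HS(K, Hᵃ(X)(s))` for `a ≤ 1`. [cite: VoisinHodgeI2002, §6.2.3 Cor. 6.26 and §7.3.1 Lemma 7.23] [cite: DeligneHodgeII1971, 2.1.13–2.1.14] -/
theorem BettiUniverse.finrank_hom_primitiveHodge_tateTwist_right_of_le_one (hHD : exists_isReal_hodgeModel) (hX : IsSmoothProjective n X) (D : KaehlerRationalDatum n X) {a : ℕ}
    (ha1 : a ≤ 1) (han : a ≤ n) {W : Type} [AddCommGroup W] [Module ℚ W] {w : ℤ} (K : HodgeStructure W w) {s : ℤ} (hw : (a : ℤ) - 2 * s = w) :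
    Module.finrank ℚ (Hom K (((BettiUniverse.primitiveHodge hHD hX D a).tateTwist s).cast hw)) = Module.finrank ℚ (Hom K (((BettiUniverse.hodge hHD hX a).tateTwist s).cast hw)) :=
  Hom.finrank_hom_eq_of_bijective_right ((BettiUniverse.primitiveSubHodge hHD hX D a).subtypeHom.twistCast s hw)
    (BettiUniverse.subtypeHom_primitiveSubHodge_bijective_of_le_one hHD hX D ha1 han) K

/-- A sum over the Lefschetz index set of degree `3` has the two terms `(3, 0)` and `(1, 1)`. [folklore] -/
private theorem sum_lefschetzIndex_three {M : Type*} [AddCommMonoid M] (G : {p : ℕ × ℕ // p.1 + 2 * p.2 = 3} → M) :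
    ∑ p, G p = G ⟨(3, 0), rfl⟩ + G ⟨(1, 1), rfl⟩ :=
  Fintype.sum_eq_add _ _ (fun h ↦ by have := congrArg (fun q : {p : ℕ × ℕ // p.1 + 2 * p.2 = 3} ↦ q.1.1) h; exact absurd this (by decide))
    fun p hp ↦ by
      rcases lefschetzIndex_three_eq p with h | h
      · exact absurd h hp.1
      · exact absurd h hp.2

/-- A sum over the Lefschetz index set of degree `1` has the single term `(1, 0)`. [folklore] -/
private theorem sum_lefschetzIndex_one {M : Type*} [AddCommMonoid M] (G : {p : ℕ × ℕ // p.1 + 2 * p.2 = 1} → M) : ∑ p, G p = G ⟨(1, 0), rfl⟩ :=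
  Fintype.sum_eq_single _ fun p hp ↦ absurd (lefschetzIndex_one_eq p) hp

/-- **`dim_ℚ Hom_HS(H³(Y), H³(Z)) = dim_ℚ Hom_HS(P³(Y), P³(Z)) + dim_ℚ Hom_HS(P³(Y), H¹(Z)(−1)) + dim_ℚ Hom_HS(H¹(Y), P³(Z)(1)) + dim_ℚ Hom_HS(H¹(Y), H¹(Z))`** for `dim Y, dim Z ≥ 3`
(the four blocks along `H³ = P³ ⊕ L H¹`, `L H¹ ≅ H¹(−1)`, `P¹ = H¹`). [cite: VoisinHodgeI2002, §6.2.3 Thm. 6.25, Cor. 6.26, Rem. 6.27 and §7.3.1 Lemma 7.23, Lemma 7.26] [cite: DeligneHodgeII1971, 2.1, 2.1.13–2.1.14] -/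
theorem BettiUniverse.finrank_hom_hodge_three_eq_primitiveHodge (hHD : exists_isReal_hodgeModel) (hY : IsSmoothProjective m Y) (hZ : IsSmoothProjective n Z)
    (DY : KaehlerRationalDatum m Y) (DZ : KaehlerRationalDatum n Z) (hm : 3 ≤ m) (hn : 3 ≤ n) :
    Module.finrank ℚ (Hom (BettiUniverse.hodge hHD hY 3) (BettiUniverse.hodge hHD hZ 3)) =
      Module.finrank ℚ (Hom (BettiUniverse.primitiveHodge hHD hY DY 3) (BettiUniverse.primitiveHodge hHD hZ DZ 3)) +
        Module.finrank ℚ (Hom (BettiUniverse.primitiveHodge hHD hY DY 3) (((BettiUniverse.hodge hHD hZ 1).tateTwist (-1)).cast (by norm_num))) +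
        Module.finrank ℚ (Hom (BettiUniverse.hodge hHD hY 1) (((BettiUniverse.primitiveHodge hHD hZ DZ 3).tateTwist 1).cast (by norm_num))) +
        Module.finrank ℚ (Hom (BettiUniverse.hodge hHD hY 1) (BettiUniverse.hodge hHD hZ 1)) := by
  rw [BettiUniverse.finrank_hom_hodge_eq_sum_sum_primitiveHodge hHD hY hZ DY DZ 3, sum_lefschetzIndex_three, sum_lefschetzIndex_three, sum_lefschetzIndex_three]
  dsimp only
  rw [if_pos (show 3 + 0 ≤ m ∧ 3 + 0 ≤ n by omega), if_pos (show 3 + 0 ≤ m ∧ 1 + 1 ≤ n by omega), if_pos (show 1 + 1 ≤ m ∧ 3 + 0 ≤ n by omega),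
    if_pos (show 1 + 1 ≤ m ∧ 1 + 1 ≤ n by omega)]
  have e1 : Module.finrank ℚ (Hom (BettiUniverse.primitiveHodge hHD hY DY 3) (((BettiUniverse.primitiveHodge hHD hZ DZ 3).tateTwist (((0 : ℕ) : ℤ) - ((0 : ℕ) : ℤ))).cast (by norm_num))) =
      Module.finrank ℚ (Hom (BettiUniverse.primitiveHodge hHD hY DY 3) (BettiUniverse.primitiveHodge hHD hZ DZ 3)) := by
    rw [finrank_hom_twistCast_right_congr _ _ (show ((0 : ℕ) : ℤ) - ((0 : ℕ) : ℤ) = 0 by norm_num) _ (by norm_num), finrank_hom_twistCast_zero_right]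
  have e2 : Module.finrank ℚ (Hom (BettiUniverse.primitiveHodge hHD hY DY 3) (((BettiUniverse.primitiveHodge hHD hZ DZ 1).tateTwist (((0 : ℕ) : ℤ) - ((1 : ℕ) : ℤ))).cast (by norm_num))) =
      Module.finrank ℚ (Hom (BettiUniverse.primitiveHodge hHD hY DY 3) (((BettiUniverse.hodge hHD hZ 1).tateTwist (-1)).cast (by norm_num))) := by
    rw [finrank_hom_twistCast_right_congr _ _ (show ((0 : ℕ) : ℤ) - ((1 : ℕ) : ℤ) = -1 by norm_num) _ (by norm_num),
      BettiUniverse.finrank_hom_primitiveHodge_tateTwist_right_of_le_one hHD hZ DZ (a := 1) le_rfl (show 1 ≤ n by omega)]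
  have e3 : Module.finrank ℚ (Hom (BettiUniverse.primitiveHodge hHD hY DY 1) (((BettiUniverse.primitiveHodge hHD hZ DZ 3).tateTwist (((1 : ℕ) : ℤ) - ((0 : ℕ) : ℤ))).cast (by norm_num))) =
      Module.finrank ℚ (Hom (BettiUniverse.hodge hHD hY 1) (((BettiUniverse.primitiveHodge hHD hZ DZ 3).tateTwist 1).cast (by norm_num))) := by
    rw [finrank_hom_twistCast_right_congr _ _ (show ((1 : ℕ) : ℤ) - ((0 : ℕ) : ℤ) = 1 by norm_num) _ (by norm_num),
      BettiUniverse.finrank_hom_primitiveHodge_left_of_le_one hHD hY DY (a := 1) le_rfl (show 1 ≤ m by omega)]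
  have e4 : Module.finrank ℚ (Hom (BettiUniverse.primitiveHodge hHD hY DY 1) (((BettiUniverse.primitiveHodge hHD hZ DZ 1).tateTwist (((1 : ℕ) : ℤ) - ((1 : ℕ) : ℤ))).cast (by norm_num))) =
      Module.finrank ℚ (Hom (BettiUniverse.hodge hHD hY 1) (BettiUniverse.hodge hHD hZ 1)) := by
    rw [finrank_hom_twistCast_right_congr _ _ (show ((1 : ℕ) : ℤ) - ((1 : ℕ) : ℤ) = 0 by norm_num) _ (by norm_num),
      BettiUniverse.finrank_hom_primitiveHodge_tateTwist_right_of_le_one hHD hZ DZ (a := 1) le_rfl (show 1 ≤ n by omega), finrank_hom_twistCast_zero_right,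
      BettiUniverse.finrank_hom_primitiveHodge_left_of_le_one hHD hY DY (a := 1) le_rfl (show 1 ≤ m by omega)]
  rw [e1, e2, e3, e4]
  ring

/-- **`dim_ℚ Hom_HS(H¹(Y), H³(Z)(1)) = dim_ℚ Hom_HS(H¹(Y), P³(Z)(1)) + dim_ℚ Hom_HS(H¹(Y), H¹(Z))`** for `dim Z ≥ 3`, `dim Y ≥ 1` (`H³(Z)(1) = P³(Z)(1) ⊕ (L H¹(Z))(1)` with `(L H¹(Z))(1) ≅ H¹(Z)`).
[cite: VoisinHodgeI2002, §6.2.3 Thm. 6.25, Cor. 6.26, Rem. 6.27 and §7.3.1 Lemma 7.23, Lemma 7.26] [cite: DeligneHodgeII1971, 2.1, 2.1.13–2.1.14] -/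
theorem BettiUniverse.finrank_hom_hodge_one_three_twist_eq_primitiveHodge (hHD : exists_isReal_hodgeModel) (hY : IsSmoothProjective m Y) (hZ : IsSmoothProjective n Z)
    (DZ : KaehlerRationalDatum n Z) (hm : 1 ≤ m) (hn : 3 ≤ n) :
    Module.finrank ℚ (Hom (BettiUniverse.hodge hHD hY 1) (((BettiUniverse.hodge hHD hZ 3).tateTwist 1).cast (by norm_num))) =
      Module.finrank ℚ (Hom (BettiUniverse.hodge hHD hY 1) (((BettiUniverse.primitiveHodge hHD hZ DZ 3).tateTwist 1).cast (by norm_num))) +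
        Module.finrank ℚ (Hom (BettiUniverse.hodge hHD hY 1) (BettiUniverse.hodge hHD hZ 1)) := by
  obtain ⟨DY⟩ := nonempty_kaehlerRationalDatum hY
  rw [BettiUniverse.finrank_hom_hodge_tateTwist_eq_sum_sum_primitiveHodge hHD hY hZ DY DZ 1 3 (s := 1) (by norm_num), sum_lefschetzIndex_one, sum_lefschetzIndex_three]
  dsimp only
  rw [if_pos (show 1 + 0 ≤ m ∧ 3 + 0 ≤ n by omega), if_pos (show 1 + 0 ≤ m ∧ 1 + 1 ≤ n by omega)]
  have e1 : Module.finrank ℚ (Hom (BettiUniverse.primitiveHodge hHD hY DY 1) (((BettiUniverse.primitiveHodge hHD hZ DZ 3).tateTwist (1 + ((0 : ℕ) : ℤ) - ((0 : ℕ) : ℤ))).cast (by norm_num))) =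
      Module.finrank ℚ (Hom (BettiUniverse.hodge hHD hY 1) (((BettiUniverse.primitiveHodge hHD hZ DZ 3).tateTwist 1).cast (by norm_num))) := by
    rw [finrank_hom_twistCast_right_congr _ _ (show (1 : ℤ) + ((0 : ℕ) : ℤ) - ((0 : ℕ) : ℤ) = 1 by norm_num) _ (by norm_num),
      BettiUniverse.finrank_hom_primitiveHodge_left_of_le_one hHD hY DY (a := 1) le_rfl hm]
  have e2 : Module.finrank ℚ (Hom (BettiUniverse.primitiveHodge hHD hY DY 1) (((BettiUniverse.primitiveHodge hHD hZ DZ 1).tateTwist (1 + ((0 : ℕ) : ℤ) - ((1 : ℕ) : ℤ))).cast (by norm_num))) =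
      Module.finrank ℚ (Hom (BettiUniverse.hodge hHD hY 1) (BettiUniverse.hodge hHD hZ 1)) := by
    rw [finrank_hom_twistCast_right_congr _ _ (show (1 : ℤ) + ((0 : ℕ) : ℤ) - ((1 : ℕ) : ℤ) = 0 by norm_num) _ (by norm_num),
      BettiUniverse.finrank_hom_primitiveHodge_tateTwist_right_of_le_one hHD hZ DZ (a := 1) le_rfl (show 1 ≤ n by omega), finrank_hom_twistCast_zero_right,
      BettiUniverse.finrank_hom_primitiveHodge_left_of_le_one hHD hY DY (a := 1) le_rfl hm]
  rw [e1, e2]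

end DegreeThree

section Shift

/-- **Lefschetz monotonicity of the vanishing of `Hom_HS`: `Hom_HS(H^{i+2k}(Y), H^{j+2k'}(Z)(s + k' − k)) = 0 ⟹ Hom_HS(Hⁱ(Y), Hʲ(Z)(s)) = 0`** for `i + k ≤ dim Y` (or `k = 0`) and
`j + k' ≤ dim Z` (or `k' = 0`): every block
`Hom_HS(Pᵃ(Y), Pᵇ(Z)(s + t − t'))` of the latter (`a + 2t = i`, `b + 2t' = j` admissible) is the block `((a, t + k), (b, t' + k'))` of the former — `Lᵏ : Hⁱ(Y) ↪ H^{i+2k}(Y)(k)` and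
`Lᵏ' : Hʲ(Z) ↪ H^{j+2k'}(Z)(k')` embed sub-Hodge structures below the middle degree. [cite: VoisinHodgeI2002, §6.2.3 Thm. 6.25, Cor. 6.26, Rem. 6.27 and §7.3.1 Lemma 7.23, Lemma 7.26]
[cite: DeligneHodgeII1971, 2.1, 2.1.13–2.1.14] -/
theorem BettiUniverse.subsingleton_hom_hodge_tateTwist_of_shift (hHD : exists_isReal_hodgeModel) (hY : IsSmoothProjective m Y) (hZ : IsSmoothProjective n Z) {i j k k' : ℕ}
    (hik : k = 0 ∨ i + k ≤ m) (hjk : k' = 0 ∨ j + k' ≤ n) {s s' : ℤ} (hs : (j : ℤ) - 2 * s = i) (hss' : s + k' - k = s') (hs' : ((j + 2 * k' : ℕ) : ℤ) - 2 * s' = ((i + 2 * k : ℕ) : ℤ))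
    (h : Subsingleton (Hom (BettiUniverse.hodge hHD hY (i + 2 * k)) (((BettiUniverse.hodge hHD hZ (j + 2 * k')).tateTwist s').cast hs'))) :
    Subsingleton (Hom (BettiUniverse.hodge hHD hY i) (((BettiUniverse.hodge hHD hZ j).tateTwist s).cast hs)) := by
  obtain ⟨DY⟩ := nonempty_kaehlerRationalDatum hY
  obtain ⟨DZ⟩ := nonempty_kaehlerRationalDatum hZ
  rw [BettiUniverse.subsingleton_hom_hodge_tateTwist_iff_primitiveHodge hHD hY hZ DY DZ (i + 2 * k) (j + 2 * k') hs'] at h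
  rw [BettiUniverse.subsingleton_hom_hodge_tateTwist_iff_primitiveHodge hHD hY hZ DY DZ i j hs]
  intro p q hp hq
  have hp2 := p.2
  have hq2 := q.2
  have hb := h ⟨(p.1.1, p.1.2 + k), by dsimp only; omega⟩ ⟨(q.1.1, q.1.2 + k'), by dsimp only; omega⟩ (by rcases hik with rfl | hik <;> dsimp only <;> omega)
    (by rcases hjk with rfl | hjk <;> dsimp only <;> omega)
  exact (subsingleton_hom_twistCast_right_congr _ _ (by push_cast; omega) _ _).1 hb

/-- **`Hom_HS(H^{i+2k}(Y), H^{i+2k}(Z)) = 0 ⟹ Hom_HS(Hⁱ(Y), Hⁱ(Z)) = 0`** for `i + k ≤ dim Y, dim Z` (both sides shifted by `Lᵏ`; e.g. `Hom_HS(H³, H³) = 0 ⟹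
Hom_HS(H¹, H¹) = 0`, §2). [cite: VoisinHodgeI2002, §6.2.3 Thm. 6.25, Cor. 6.26, Rem. 6.27 and §7.3.1 Lemma 7.23, Lemma 7.26] [cite: DeligneHodgeII1971, 2.1] -/
theorem BettiUniverse.subsingleton_hom_hodge_of_shift (hHD : exists_isReal_hodgeModel) (hY : IsSmoothProjective m Y) (hZ : IsSmoothProjective n Z) {i k : ℕ} (hik : i + k ≤ m)
    (hik' : i + k ≤ n) (h : Subsingleton (Hom (BettiUniverse.hodge hHD hY (i + 2 * k)) (BettiUniverse.hodge hHD hZ (i + 2 * k)))) :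
    Subsingleton (Hom (BettiUniverse.hodge hHD hY i) (BettiUniverse.hodge hHD hZ i)) :=
  (subsingleton_hom_twistCast_zero_right_iff _ _ (by omega)).1
    (BettiUniverse.subsingleton_hom_hodge_tateTwist_of_shift hHD hY hZ (Or.inr hik) (Or.inr hik') (s := 0) (by omega) (by ring) _
      ((subsingleton_hom_twistCast_zero_right_iff _ _ (by omega)).2 h))

/-- **`Hom_HS(H^{i+2k}(Y), Hʲ(Z)) = 0 ⟹ Hom_HS(Hⁱ(Y), Hʲ(Z)(k)) = 0`** for `i + k ≤ dim Y` (`j = i + 2k`; the source-side shift: e.g. `Hom_HS(H³(Y), H³(Z)) = 0 ⟹ Hom_HS(H¹(Y), H³(Z)(1)) = 0`, §2).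
[cite: VoisinHodgeI2002, §6.2.3 Thm. 6.25, Cor. 6.26, Rem. 6.27 and §7.3.1 Lemma 7.23, Lemma 7.26] [cite: DeligneHodgeII1971, 2.1, 2.1.13–2.1.14] -/
theorem BettiUniverse.subsingleton_hom_hodge_tateTwist_of_shift_left (hHD : exists_isReal_hodgeModel) (hY : IsSmoothProjective m Y) (hZ : IsSmoothProjective n Z) {i j k : ℕ}
    (hik : i + k ≤ m) (hj : i + 2 * k = j) (hs : (j : ℤ) - 2 * (k : ℤ) = i) (h : Subsingleton (Hom (BettiUniverse.hodge hHD hY j) (BettiUniverse.hodge hHD hZ j))) :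
    Subsingleton (Hom (BettiUniverse.hodge hHD hY i) (((BettiUniverse.hodge hHD hZ j).tateTwist k).cast hs)) := by
  subst hj
  exact BettiUniverse.subsingleton_hom_hodge_tateTwist_of_shift hHD hY hZ (Or.inr hik) (k' := 0) (Or.inl rfl) hs (by push_cast; ring) (by push_cast; ring)
    ((subsingleton_hom_twistCast_zero_right_iff _ _ (by omega)).2 h)

end Shift

end Literature.AlgebraicGeometry.HodgeTheory

end
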